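import Mathlib
import HarnessLib
import Literature.Analysis.FluidPDE.SuitableWeak
import Literature.Analysis.FluidPDE.SelfSimilar
import Literature.Analysis.FluidPDE.LocalTypeI
import Literature.Analysis.FluidPDE.SpaceTimeRescaling
import Literature.Analysis.FluidPDE.LocalTypeIScaling
import Literature.Analysis.FluidPDE.LocalTypeICongr
import Literature.Analysis.FluidPDE.LocalTypeILscGradient
import Literature.Analysis.FluidPDE.SlabTypeICompactness
import Literature.Analysis.FluidPDE.SlabTypeICompactnessSharp
import Literature.Analysis.FluidPDE.TypeIRateOseenMildRepresentative
import Literature.Analysis.FluidPDE.OseenMildUniqueness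
import Literature.Analysis.FluidPDE.NSBoundedMildAnalytic
import Literature.Analysis.FluidPDE.SpaceTimeMollifier
import Summits.NavierStokesRegularity.NavierStokesRegularity.Theorems.RellichScarApexLocalisationSpherePersistence
import Summits.NavierStokesRegularity.NavierStokesRegularity.Theorems.RellichScarApexLocalisationMovingCentrePersistence
import Summits.NavierStokesRegularity.NavierStokesRegularity.Theorems.RellichScarApexLocalisationParentChild
import Summits.NavierStokesRegularity.NavierStokesRegularity.Theorems.RellichScarApexLocalisationReductionV3
import Summits.NavierStokesRegularity.NavierStokesRegularity.Theorems.RellichScarApexLocalisationParabolicActivity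
import Summits.NavierStokesRegularity.NavierStokesRegularity.Theorems.RellichScarApexLocalisationSliceConstant
import Summits.NavierStokesRegularity.NavierStokesRegularity.Theorems.RellichScarApexLocalisationAnalyticSpread
import Summits.NavierStokesRegularity.NavierStokesRegularity.Theorems.RellichScarApexLocalisationBandQuantum
import Summits.NavierStokesRegularity.NavierStokesRegularity.Theorems.RellichScarApexLocalisationQuantumAccounting
import Summits.NavierStokesRegularity.NavierStokesRegularity.Theorems.RellichScarApexLocalisationQuantumCovariance
import Summits.NavierStokesRegularity.NavierStokesRegularity.Theorems.RellichScarApexLocalisationTightIsApex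
import Summits.NavierStokesRegularity.NavierStokesRegularity.Theorems.RellichScarApexLocalisationTightIsApexKappa
import Summits.NavierStokesRegularity.NavierStokesRegularity.Theorems.RellichScarApexLocalisationPackingSum
import Summits.NavierStokesRegularity.NavierStokesRegularity.Theorems.RellichScarApexLocalisationQuantumAccountingSharp
import Summits.NavierStokesRegularity.NavierStokesRegularity.Theses.RellichScar

/-!
# Skeleton v2.1 — line `dissipation-quantum-tolerance` for crux `RellichScar.ApexLocalisation`
(stmt-NavierStokesRegularity-11719; leads prover-line-stmt-NavierStokesRegularity-11719-c3-0 (v1, v2) and -c4-0 (v2.1))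

Continuous class of the landed `RellichScarApexLocalisation*` files: class data of a profile `(u,p,G)` with
constants `(C, I)` are `IsSuitableWeakSolutionOn 𝕊 1 0 u p`, `HasWeakSpatialGradientOn 𝕊 u G`,
`typeIBound (Iio 0 ×ˢ univ) u p G ≤ I` (`I < ⊤`), `HasTypeITimeDecay C u`,
`ContinuousOn (uncurry u) (Iio 0 ×ˢ univ)`, `𝕊 = slab (EuclideanSpace ℝ (Fin 3)) (Iio 0) isOpen_Iio`.
Dissipation is measured on the parabolic BANDS `B(ρ, b) := Q((−ρ²/4, b), ρ/2) = (−ρ²/2, −ρ²/4) × B_{ρ/2}(b)`;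
the unit band is `B(1, 0) = Q((−1/4, 0), 1/2)`.

LANDED (wave 1 + lead, all ACCEPTED; imported, same names):
* `stub_sliceConstant` (S1, p116901) — zero weak gradient on the band + continuity ⇒ constant slices;
* `stub_analyticSpread` (S2, p117169) — Oseen-mild analyticity + Morrey ⇒ a field with constant band slices vanishes;
* `stub_bandQuantumPos` (S3, p118088) — THE DISSIPATION QUANTUM `e(C,I) > 0` at every origin-singular class profile;
* `stub_quantumAccounting` (S4, p117425) — coarse accounting (dyadic grid): floor `2e`, one companion ⇒ `(9/4) e`;
* `stub_quantumCovariance` (S5, p118116) — the quantum at every singular final-slice point, every scale;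
* `stub_tightIsApex` (S6, p118533) — tight (`sup_r E < (9/4) e`) ⇒ apex.

WHY A v2 (lead's finding, cycle 1): the v1 bet (`stub_tightProfileExists`, ∀e-form, threshold `9/4`) is
VACUOUS — (i) band quanta are closed downward in `e`, so "for every quantum `e`" lets `e → 0`; (ii) the
quantum at ALL scales yields pairwise disjoint bands along the `√2`-GRID `ρ_j = R 2^{-j/2}` (their time
windows `(−ρ²/2,−ρ²/4)` have log-length `log 2` and tile `(−R², 0)`), so every origin-singular profile
already pays `E(Q((0,0),R)) ≥ (2+2√2) e ≈ 4.83 e > (9/4) e` (sharp for the band constraints alone: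
density `e(1+√2)|t|^{-1/2}` on the axis), and no profile is `(9/4)e`-tight.  Certificate:
`tightProfileExistsV1_iff` (v1 bet ⇔ no rate-Type-I singular profile at all) in
`…Theorems.RellichScarApexLocalisationVacuityV1`.  The companion count with the `√2`-grid and balls of
radius `ρ/2` (companion scales `ρ ≤ s`, not `s/4`) gives `E(Q((0,0),2s)) ≥ (3 + 5√2/2) e ≈ 6.54 e`.

v2 STUBS (reshape; composition idea unchanged):
* `stub_quantumAccountingSharp` (S4', LANDED p119404 — pure measure theory, sequel of S4): floor `(2+2√2) e`;
  mother + one companion at distance `s` ⇒ `E(Q((0,0),2s)) ≥ (3 + 5√2/2) e` (OPTIMAL: an equality path measure exists).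
* `stub_tightIsApexKappa` (S6κ, LANDED p119914 — `…Theorems.RellichScarApexLocalisationTightIsApexKappa`, imported, same name:
  the landed S6 proof with the threshold as a parameter `κ`).
* `stub_tightProfileExistsV2` (S7', THE BET, ∃e-form, `κ = 3 + 5√2/2`): if a rate-Type-I singular slab
  profile exists, some class `(C₁, I₁)` carries a unit-band quantum `e > 0` of `(C₁, 4I₁)` and an
  origin-singular continuous `(C₁, I₁)` profile with `sup_r E(Q((0,0),r)) < (3 + 5√2/2) e` — total scaled
  dissipation within 35 % of the quantum floor `(2+2√2) e`.  A SUFFICIENT condition for the crux, not an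
  equivalent form; (L)-vacuous; its regime `[(2+2√2)e, (3+5√2/2)e)` asks for a near-minimiser of band
  dissipation at every scale with small off-band dissipation (the saturated envelope `(‖x‖+√−t)^{-4}` puts
  7/8 of its dissipation outside the aperture-1 core: triage r1-3).
* `stub_packingSum` (by-product, LANDED p118885): the SCALE-SUMMED PACKING BOUND `Σ_j 2^{-j} #S_j ≤ 2I/e` for
  `R 2^{-j}`-separated finite sets `S_j` of final-slice singular points in `B̄_R(x₀)` — a Dini-type sparsity
  strictly beyond CKN's `ℋ¹(Σ) = 0` at the final slice (corollary `packingSum`).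

Composition `ApexLocalisation_of`: S7' ⇒ `(C₁, I₁, e)` + quantum + tight profile; S5 spreads the quantum;
S6κ (κ = 3+5√2/2, fed S4'(b)) ⇒ `HasTypeIDecay C'`; the profile's own `𝐈 ≤ I₁ < ⊤` and singular origin
give the crux.  Corollary `dissipationFloorSharp` (S3 + S5 + S4'(a), unconditional): every origin-singular
continuous class profile pays `E(Q((0,0),R)) ≥ (2+2√2) e(C,I) > 0` at EVERY scale.
Everything is INLINED (no new definitions).

v2.1 (lead c4): S6κ imported from its landed file; the ONLY `sorry` left is the bet `stub_tightProfileExistsV2`.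
-/

-- the summit and its single sub-problem share the name (CONVENTIONS §1), as in every Theorems file
set_option linter.dupNamespace false

namespace Summit.NavierStokesRegularity.NavierStokesRegularity.Theorems.RellichScarApexLocalisation

open MeasureTheory Set Function Metric Filter Topology TopologicalSpace
open scoped ENNReal NNReal
open Literature.Analysis Literature.Analysis.FluidPDE

local notation "E³" => EuclideanSpace ℝ (Fin 3)

/-! ### Stubs S1–S6 — LANDED (imported above, same names)

* `stub_sliceConstant`     — `…Theorems.RellichScarApexLocalisationSliceConstant` (p116901)
* `stub_analyticSpread`    — `…Theorems.RellichScarApexLocalisationAnalyticSpread` (p117169)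
* `stub_bandQuantumPos`    — `…Theorems.RellichScarApexLocalisationBandQuantum` (p118088) — THE QUANTUM
* `stub_quantumAccounting` — `…Theorems.RellichScarApexLocalisationQuantumAccounting` (p117425)
* `stub_quantumCovariance` — `…Theorems.RellichScarApexLocalisationQuantumCovariance` (p118116)
* `stub_tightIsApex`       — `…Theorems.RellichScarApexLocalisationTightIsApex` (p118533)
-/

/-! ### S4' — `stub_quantumAccountingSharp`: LANDED (`…Theorems.RellichScarApexLocalisationQuantumAccountingSharp`, p119404) -/

/-! ### S6κ — `stub_tightIsApexKappa`: LANDED (`…Theorems.RellichScarApexLocalisationTightIsApexKappa`, p119914) — tight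
(`sup_r E(Q((0,0),r)) < κ e`) + singular ⇒ apex, threshold `κ` a parameter, fed an accounting input with the same `κ`. -/

/-! ### S7' — THE BET (v2) -/

/-- **S7', A DISSIPATION-TIGHT SINGULAR PROFILE EXISTS (THE BET, v2: ∃e-form, sharp threshold).** If a
rate-Type-I singular slab profile with constant `C` exists (the crux antecedent), then for some
continuous class `(C₁, I₁)`, `I₁ < ⊤`, and some `e > 0` which is a unit-band dissipation quantum for the
origin-singular continuous profiles of the class `(C₁, 4I₁)`, SOME origin-singular continuous
class-`(C₁,I₁)` profile is dissipation-tight: `sup_{r>0} E(Q((0,0),r)) < (3 + 5√2/2) e` — total scaled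
dissipation within 35 % of the quantum floor `(2+2√2) e`.  A SUFFICIENT condition for the crux (by S4',
S5, S6κ), not an equivalent form: the card's regime statement "near-minimal dissipators are isolated,
hereditarily", re-tuned to the true floor.  Its enemy is off-band dissipation: a Type-I envelope
`(‖x‖+√−t)^{-4}` carries 7/8 of its dissipation outside the aperture-1 core that the bands see. -/
theorem stub_tightProfileExistsV2 :
    ∀ C : ℝ, (∃ (u : ℝ → E³ → E³) (p : ℝ → E³ → ℝ) (G : ℝ → E³ → E³ →L[ℝ] E³),
        IsSuitableWeakSolutionOn (slab E³ (Iio 0) isOpen_Iio) 1 0 u p ∧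
        HasWeakSpatialGradientOn (slab E³ (Iio 0) isOpen_Iio) u G ∧
        typeIBound (Set.Iio (0 : ℝ) ×ˢ Set.univ) u p G < ⊤ ∧ HasTypeITimeDecay C u ∧
        IsBackwardSingularPoint u 0) →
      ∃ (C₁ : ℝ) (I₁ : ℝ≥0∞) (e : ℝ), I₁ < ⊤ ∧ 0 < e ∧
        (∀ (v : ℝ → E³ → E³) (q : ℝ → E³ → ℝ) (H : ℝ → E³ → E³ →L[ℝ] E³),
          IsSuitableWeakSolutionOn (slab E³ (Iio 0) isOpen_Iio) 1 0 v q →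
          HasWeakSpatialGradientOn (slab E³ (Iio 0) isOpen_Iio) v H →
          typeIBound (Iio (0 : ℝ) ×ˢ univ) v q H ≤ 4 * I₁ →
          HasTypeITimeDecay C₁ v →
          ContinuousOn (uncurry v) (Iio (0 : ℝ) ×ˢ univ) →
          IsBackwardSingularPoint v 0 →
          ENNReal.ofReal e ≤ ∫⁻ z in parabolicCylinder (1 / 2 : ℝ) ((-(1 / 4) : ℝ), (0 : E³)),
            ENNReal.ofReal (frobeniusNormSq (H z.1 z.2))) ∧
        ∃ (u : ℝ → E³ → E³) (p : ℝ → E³ → ℝ) (G : ℝ → E³ → E³ →L[ℝ] E³),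
          IsSuitableWeakSolutionOn (slab E³ (Iio 0) isOpen_Iio) 1 0 u p ∧
          HasWeakSpatialGradientOn (slab E³ (Iio 0) isOpen_Iio) u G ∧
          typeIBound (Iio (0 : ℝ) ×ˢ univ) u p G ≤ I₁ ∧
          HasTypeITimeDecay C₁ u ∧
          ContinuousOn (uncurry u) (Iio (0 : ℝ) ×ˢ univ) ∧
          IsBackwardSingularPoint u 0 ∧
          (⨆ (r : ℝ) (_ : 0 < r), cknE r ((0 : ℝ), (0 : E³)) G) <
            ENNReal.ofReal ((3 + 5 / 2 * Real.sqrt 2) * e) := by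
  sorry

/-! ### Composition -/

/-- **The v2 bet implies the crux**: the bet selects a class `(C₁, I₁)`, a quantum `e` of `(C₁, 4I₁)`
and a tight origin-singular profile; covariance (S5, landed) spreads the quantum; tightness (S6κ with
`κ = 3 + 5√2/2`, fed S4'(b)) makes the profile apex; its own `𝐈 ≤ I₁ < ⊤` and singular origin complete
the crux conclusion. -/
theorem apexLocalisation_of_tightProfileExistsV2
    (hbet : ∀ C : ℝ, (∃ (u : ℝ → E³ → E³) (p : ℝ → E³ → ℝ) (G : ℝ → E³ → E³ →L[ℝ] E³),
        IsSuitableWeakSolutionOn (slab E³ (Iio 0) isOpen_Iio) 1 0 u p ∧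
        HasWeakSpatialGradientOn (slab E³ (Iio 0) isOpen_Iio) u G ∧
        typeIBound (Set.Iio (0 : ℝ) ×ˢ Set.univ) u p G < ⊤ ∧ HasTypeITimeDecay C u ∧
        IsBackwardSingularPoint u 0) →
      ∃ (C₁ : ℝ) (I₁ : ℝ≥0∞) (e : ℝ), I₁ < ⊤ ∧ 0 < e ∧
        (∀ (v : ℝ → E³ → E³) (q : ℝ → E³ → ℝ) (H : ℝ → E³ → E³ →L[ℝ] E³),
          IsSuitableWeakSolutionOn (slab E³ (Iio 0) isOpen_Iio) 1 0 v q →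
          HasWeakSpatialGradientOn (slab E³ (Iio 0) isOpen_Iio) v H →
          typeIBound (Iio (0 : ℝ) ×ˢ univ) v q H ≤ 4 * I₁ →
          HasTypeITimeDecay C₁ v →
          ContinuousOn (uncurry v) (Iio (0 : ℝ) ×ˢ univ) →
          IsBackwardSingularPoint v 0 →
          ENNReal.ofReal e ≤ ∫⁻ z in parabolicCylinder (1 / 2 : ℝ) ((-(1 / 4) : ℝ), (0 : E³)),
            ENNReal.ofReal (frobeniusNormSq (H z.1 z.2))) ∧
        ∃ (u : ℝ → E³ → E³) (p : ℝ → E³ → ℝ) (G : ℝ → E³ → E³ →L[ℝ] E³),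
          IsSuitableWeakSolutionOn (slab E³ (Iio 0) isOpen_Iio) 1 0 u p ∧
          HasWeakSpatialGradientOn (slab E³ (Iio 0) isOpen_Iio) u G ∧
          typeIBound (Iio (0 : ℝ) ×ˢ univ) u p G ≤ I₁ ∧
          HasTypeITimeDecay C₁ u ∧
          ContinuousOn (uncurry u) (Iio (0 : ℝ) ×ˢ univ) ∧
          IsBackwardSingularPoint u 0 ∧
          (⨆ (r : ℝ) (_ : 0 < r), cknE r ((0 : ℝ), (0 : E³)) G) <
            ENNReal.ofReal ((3 + 5 / 2 * Real.sqrt 2) * e)) :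
    Summit.NavierStokesRegularity.NavierStokesRegularity.Theses.RellichScar.ApexLocalisation := by
  intro C hant
  obtain ⟨C₁, I₁, e, hI₁, he, hq, u, p, G, hsw, hwg, hIle, hC, hcont, hsing, htight⟩ := hbet C hant
  have hgen := stub_quantumCovariance C₁ (4 * I₁) e he.le hq
  obtain ⟨C', hapex⟩ := stub_tightIsApexKappa (3 + 5 / 2 * Real.sqrt 2) stub_quantumAccountingSharp.2
    C₁ I₁ e hI₁ he hgen u p G hsw hwg hIle hC hcont hsing htight
  exact ⟨C', u, p, G, hsw, hwg, lt_of_le_of_lt hIle hI₁, hapex, hsing⟩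

/-- COMPOSITION of the line `dissipation-quantum-tolerance` (v2): the stubs imply the crux
`RellichScar.ApexLocalisation` (by name). -/
theorem ApexLocalisation_of :
    Summit.NavierStokesRegularity.NavierStokesRegularity.Theses.RellichScar.ApexLocalisation :=
  apexLocalisation_of_tightProfileExistsV2 stub_tightProfileExistsV2

/-! ### Unconditional corollaries -/

/-- **DISSIPATION FLOOR, sharp** (unconditional by-product of the line, S3 + S5 + S4'(a)): for every class
`(C, I)`, `I < ⊤`, there is `e > 0` such that every continuous class profile singular at the origin has
origin-anchored scaled dissipation `E(Q((0,0),R)) = R⁻¹ ∫∫_{Q_R} |∇u|² ≥ (2+2√2) e` at EVERY scale `R > 0`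
(CKN's ε-regularity only gives `limsup_{R→0} E ≥ ε`). -/
theorem dissipationFloorSharp :
    ∀ (C : ℝ) (I : ℝ≥0∞), I < ⊤ → ∃ e : ℝ, 0 < e ∧
      ∀ (u : ℝ → E³ → E³) (p : ℝ → E³ → ℝ) (G : ℝ → E³ → E³ →L[ℝ] E³),
        IsSuitableWeakSolutionOn (slab E³ (Iio 0) isOpen_Iio) 1 0 u p →
        HasWeakSpatialGradientOn (slab E³ (Iio 0) isOpen_Iio) u G →
        typeIBound (Iio (0 : ℝ) ×ˢ univ) u p G ≤ I →
        HasTypeITimeDecay C u →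
        ContinuousOn (uncurry u) (Iio (0 : ℝ) ×ˢ univ) →
        IsBackwardSingularPoint u 0 →
        ∀ R : ℝ, 0 < R → ENNReal.ofReal ((2 + 2 * Real.sqrt 2) * e) ≤ cknE R ((0 : ℝ), (0 : E³)) G := by
  intro C I hI
  obtain ⟨e, he, hq⟩ := stub_bandQuantumPos stub_sliceConstant stub_analyticSpread C I hI
  refine ⟨e, he, fun u p G hsw hwg hIle hC hcont hsing R hR => ?_⟩
  have hgen := stub_quantumCovariance C I e he.le hq u p G hsw hwg hIle hC hcont 0 hsing
  exact stub_quantumAccountingSharp.1 G e he.le hgen R hR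

/-! ### By-product: the scale-summed packing bound (`stub_packingSum` LANDED: `…Theorems.RellichScarApexLocalisationPackingSum`, p118885) -/

/-- **PACKING SUM BOUND for the final-time singular set** (unconditional corollary, S3 + S5 +
`stub_packingSum`): for every class `(C, I)`, `I < ⊤`, there is `e > 0` such that for every
continuous class profile, every `x₀`, `R > 0` and every sequence of `R 2^{-j}`-separated finite sets
`S_j` of final-slice singular points in `B̄_R(x₀)`, `Σ_j 2^{-j} #S_j ≤ 2I/e` — uniformly over the class,
its translates, zooms and limits. (CKN give only `ℋ¹(Σ) = 0`; a set with `#S_j ≍ 2^j/j` is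
`ℋ¹`-null but violates the bound.) -/
theorem packingSum :
    ∀ (C : ℝ) (I : ℝ≥0∞), I < ⊤ → ∃ e : ℝ, 0 < e ∧
      ∀ (u : ℝ → E³ → E³) (p : ℝ → E³ → ℝ) (G : ℝ → E³ → E³ →L[ℝ] E³),
        IsSuitableWeakSolutionOn (slab E³ (Iio 0) isOpen_Iio) 1 0 u p →
        HasWeakSpatialGradientOn (slab E³ (Iio 0) isOpen_Iio) u G →
        typeIBound (Iio (0 : ℝ) ×ˢ univ) u p G ≤ I →
        HasTypeITimeDecay C u →
        ContinuousOn (uncurry u) (Iio (0 : ℝ) ×ˢ univ) →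
        ∀ (x₀ : E³) (R : ℝ), 0 < R → ∀ S : ℕ → Finset E³,
          (∀ j : ℕ, ∀ b ∈ S j, IsBackwardSingularPoint u ((0 : ℝ), b) ∧ dist b x₀ ≤ R) →
          (∀ j : ℕ, (↑(S j) : Set E³).Pairwise fun b b' => R * 2⁻¹ ^ j ≤ dist b b') →
          ∑' j : ℕ, (2⁻¹ : ℝ≥0∞) ^ j * ((S j).card : ℝ≥0∞) ≤ 2 * I / ENNReal.ofReal e := by
  intro C I hI
  obtain ⟨e, he, hq⟩ := stub_bandQuantumPos stub_sliceConstant stub_analyticSpread C I hI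
  exact ⟨e, he, stub_packingSum C I e he (stub_quantumCovariance C I e he.le hq)⟩

end Summit.NavierStokesRegularity.NavierStokesRegularity.Theorems.RellichScarApexLocalisation
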